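import Mathlib

/-!
# The confusion number of a lattice of characters — definitions for the rung `ConfusionCovering`
# (crux dir `OrbitDimensionBound`, stmt-ValiantsHypothesis-16133, route FreeSubtorus)

The rung `ConfusionCovering` of the crux workfile `Cruxes/OrbitDimensionBound/Lines/ConfusionLadder.lean` bounds the size
`m` of a `T_Λ`-equivariant affine determinantal representation of `per_n` by `C(n, ⌊n/2⌋) ≤ m · κ_{⌊n/2⌋}(Λ)`, where
`κ_d(Λ)` is the CONFUSION NUMBER of the lattice data `Λ : Fin r → ([n] ⊔ [n]) → ℤ` at level `d`: the largest number of
pairs `(S, T)` of `d`-sets of rows and columns whose indicator characters `(1_S ; 1_T) ∈ {0,1}^{[n] ⊔ [n]}` are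
congruent to a fixed one modulo `span_ℚ {Λ_i}`.  The rung is PROVED in `Theorems/` only in "class form"
(`Theorems.FreeSubtorusConfusionCovering.confusionCovering`, p177872: some middle-level pair `q` with
`C(n,⌊n/2⌋) ≤ m · #class(q)`) because the workfile's definitions `Confusion.classCount` / `Confusion.confusion` live
in a `Cruxes/` module, which `Theorems/` files cannot import.

This file gives the two quantities tree names so that the rung's VALUE form `C(n,⌊n/2⌋) ≤ m · κ_{⌊n/2⌋}(Λ)`, its dial
`κ ≤ 2^r` (Odlyzko) and its on-path record can be stated in `Theorems/` vocabulary
(`Theorems/FreeSubtorusConfusionCoveringKappa.lean`):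

* `confusedClassCard n r Λ d q` — the number of level-`d` pairs confused with `q`;
* `confusionNumber n r Λ d` — `κ_d(Λ)`, the maximum of `confusedClassCard n r Λ d q` over level-`d` pairs `q`.

Both bodies are VERBATIM the workfile's `Confusion.classCount` / `Confusion.confusion` with the workfile-local
`Confused` / `pairVec` unfolded, so `confusionNumber n r Λ d` is DEFINITIONALLY EQUAL to `Confusion.confusion n r Λ d`
(and `confusionNumber n r Λ (n / 2)` to the rung's loss `Confusion.confusionLoss n r Λ`): statements made here transfer
to the registered rung by `rfl`, and the workfile may replace its local definitions by these.  The filter predicate of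
`confusedClassCard` is literally the set-builder of the class-form theorem `confusionCovering`.
[cite: Odlyzko1988, p. 127] [cite: LandsbergRessayre2017, Thm. 2.8, §6]
-/

open Finset

-- the mandated summit-side namespace repeats a component by design (single-problem summit)
set_option linter.dupNamespace false

namespace Summit.ValiantsHypothesis.ValiantsHypothesis.Theorems.FreeSubtorusConfusionCovering

noncomputable section

open Classical in
/-- `confusedClassCard n r Λ d q`: the number of level-`d` pairs `p = (p.1, p.2)` of row/column sets
(`|p.1| = |p.2| = d`) CONFUSED with `q` — whose indicator character `(1_{p.1} ; 1_{p.2}) : Fin n ⊕ Fin n → ℤ` is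
congruent to that of `q` modulo the rational span of the generators `Λ_i` (equivalently: takes the same value as `q`'s
at a generic element of the subtorus `T_Λ`).  Verbatim the crux workfile's `Confusion.classCount n r Λ d q` with
`Confused` / `pairVec` unfolded. [cite: LandsbergRessayre2017, §6] -/
def confusedClassCard (n r : ℕ) (Λ : Fin r → (Fin n ⊕ Fin n) → ℤ) (d : ℕ)
    (q : Finset (Fin n) × Finset (Fin n)) : ℕ :=
  (univ.filter fun p : Finset (Fin n) × Finset (Fin n) =>
    p.1.card = d ∧ p.2.card = d ∧
    ∃ c : Fin r → ℚ, ∀ x : Fin n ⊕ Fin n,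
      ((Sum.elim (fun k => if k ∈ p.1 then (1 : ℤ) else 0) (fun l => if l ∈ p.2 then (1 : ℤ) else 0) x : ℤ) : ℚ) -
      ((Sum.elim (fun k => if k ∈ q.1 then (1 : ℤ) else 0) (fun l => if l ∈ q.2 then (1 : ℤ) else 0) x : ℤ) : ℚ)
        = ∑ i, c i * ((Λ i x : ℤ) : ℚ)).card

open Classical in
/-- The **confusion number** `κ_d(Λ) = confusionNumber n r Λ d` of the lattice data `Λ` at level `d`: the largest
number of level-`d` pairs confused with one fixed level-`d` pair (`Finset.sup` of `confusedClassCard n r Λ d` over the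
level-`d` pairs).  `κ_d(Λ) ≤ 2^r` (Odlyzko 1988: a translate of an `r`-dimensional subspace holds at most `2^r`
hypercube points) and `κ_d(Λ) = 1` for `Λ` in general position.  Verbatim the crux workfile's
`Confusion.confusion n r Λ d`. [cite: Odlyzko1988, p. 127] -/
def confusionNumber (n r : ℕ) (Λ : Fin r → (Fin n ⊕ Fin n) → ℤ) (d : ℕ) : ℕ :=
  (univ.filter fun q : Finset (Fin n) × Finset (Fin n) => q.1.card = d ∧ q.2.card = d).sup
    (confusedClassCard n r Λ d)

open Classical in
/-- A level-`d` pair's class count is at most the confusion number. [folklore] -/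
theorem confusedClassCard_le_confusionNumber {n r d : ℕ} (Λ : Fin r → (Fin n ⊕ Fin n) → ℤ)
    (q : Finset (Fin n) × Finset (Fin n)) (hq1 : q.1.card = d) (hq2 : q.2.card = d) :
    confusedClassCard n r Λ d q ≤ confusionNumber n r Λ d := by
  unfold confusionNumber
  exact Finset.le_sup (f := confusedClassCard n r Λ d) (Finset.mem_filter.2 ⟨Finset.mem_univ _, hq1, hq2⟩)

open Classical in
/-- A level-`d` pair lies in its own class: `1 ≤ confusedClassCard n r Λ d q`. [folklore] -/
theorem one_le_confusedClassCard {n r d : ℕ} (Λ : Fin r → (Fin n ⊕ Fin n) → ℤ)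
    (q : Finset (Fin n) × Finset (Fin n)) (hq1 : q.1.card = d) (hq2 : q.2.card = d) :
    1 ≤ confusedClassCard n r Λ d q := by
  unfold confusedClassCard
  exact Finset.one_le_card.2 ⟨q, Finset.mem_filter.2 ⟨Finset.mem_univ _, hq1, hq2, ⟨fun _ => 0, fun x => by simp⟩⟩⟩

/-- The confusion number at a level `d ≤ n` is at least `1`. [folklore] -/
theorem one_le_confusionNumber {n r d : ℕ} (Λ : Fin r → (Fin n ⊕ Fin n) → ℤ) (hd : d ≤ n) :
    1 ≤ confusionNumber n r Λ d := by
  classical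
  obtain ⟨S, hS⟩ : ((Finset.univ : Finset (Fin n)).powersetCard d).Nonempty := by
    rw [Finset.powersetCard_nonempty]; simpa using hd
  have hSc : S.card = d := (Finset.mem_powersetCard.1 hS).2
  exact (one_le_confusedClassCard Λ (S, S) hSc hSc).trans (confusedClassCard_le_confusionNumber Λ (S, S) hSc hSc)

end

end Summit.ValiantsHypothesis.ValiantsHypothesis.Theorems.FreeSubtorusConfusionCovering
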